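import Summits.BirchSwinnertonDyer.BirchSwinnertonDyer.Theorems.GenusKolyvaginAtTwoTorsionCellD0TripleTwistBound
import HarnessLib

/-!
# D0≤2, one genus step: preliminaries for the explicit aligned class of `E₀^{(−p₀q₁q₂)}`

Crux R″ `RankOneTwoTorsionResidualAtTwo` (stmt-27478), LINE 49 «full_vertex», stub D0≤2
`FullTorsionGenusSelmerLawUpToTwoAtTwo`, slice `#Q₀ = 2`, `C₁`. Small lemmas for `…D0TripleTwistEight`:

* `qrBit_natCast_eq_zero_of_forall_prime_dvd`, `qrBit_sub_roots_eq_zero_of_intCast` — (R2) on a positive `S`-unit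
  root difference: `qr_p(e' − e) = 0` when `qr_p` kills the primes of `S` (`4e, 4e' ∈ ℤ`);
* `parityBit_sq_mul`, `isSquare_adicCompletion_sq_mul_of_bits` — `x²u` with `u` a unit residue is a local square;
* `natCard_unramified_ne_one` — a non-zero `q`-unramified Selmer class makes `#N_q ≠ 1`.

Everything is proved; no LINE 49 statement is restated; BSD is not advanced by this file alone.

## References

* [SilvermanAEC2009] J. H. Silverman, *The Arithmetic of Elliptic Curves*, 2nd ed., GTM 106, Prop. X.1.4, X.4.9.
-/

noncomputable section

open scoped Classical

namespace Summit.BirchSwinnertonDyer.BirchSwinnertonDyer.Theorems.GenusKolyvaginAtTwo.TorsionCellD0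

open WeierstrassCurve WeierstrassCurve.Affine WeierstrassCurve.Affine.Point
open Literature.NumberTheory.GaloisRepresentations Literature.NumberTheory.EllipticCurves Field
open Literature.NumberTheory.EllipticCurves.TwoDescentLocal
open Literature.NumberTheory.EllipticCurves.KramerTwoDescent
open IsDedekindDomain NumberField Rat.HeightOneSpectrum

/-! ## A residue character trivial on the prime factors -/

section Trivial

variable {q : ℕ} [hq : Fact q.Prime]

/-- A residue character vanishing on the prime factors of `n ≠ 0` vanishes on `n`. [folklore] -/
theorem qrBit_natCast_eq_zero_of_forall_prime_dvd (n : ℕ) (hn : n ≠ 0)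
    (hR : ∀ ℓ : ℕ, ℓ.Prime → ℓ ∣ n → qrBit q (ℓ : ℚ) = 0) : qrBit q (n : ℚ) = 0 := by
  induction n using Nat.strong_induction_on with
  | _ n ih =>
    by_cases h1 : n = 1
    · subst h1; rw [Nat.cast_one, show (1 : ℚ) = 1 * 1 by norm_num, qrBit_mul_self]
    · have hℓ : n.minFac.Prime := Nat.minFac_prime h1
      obtain ⟨m, hm⟩ := Nat.minFac_dvd n
      have hm0 : m ≠ 0 := by rintro rfl; rw [mul_zero] at hm; exact hn hm
      have hℓ0 : (n.minFac : ℚ) ≠ 0 := by exact_mod_cast hℓ.ne_zero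
      have hmq : (m : ℚ) ≠ 0 := by exact_mod_cast hm0
      have hmlt : m < n := by
        rw [hm]; exact lt_mul_left (Nat.pos_of_ne_zero hm0) hℓ.one_lt
      have hdm : ∀ ℓ : ℕ, ℓ.Prime → ℓ ∣ m → qrBit q (ℓ : ℚ) = 0 :=
        fun ℓ hℓp hℓm => hR ℓ hℓp (hm ▸ Dvd.dvd.mul_left hℓm _)
      rw [hm, Nat.cast_mul, qrBit_mul q hℓ0 hmq, hR _ hℓ (Nat.minFac_dvd n), ih m hmlt hm0 hdm, add_zero]

/-- **(R2) on a positive root difference.** For a model with `4e, 4e' ∈ ℤ`, `e < e'`, and `v_ℓ(e − e') = 0` for every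
prime `ℓ ∉ S` (`2 ∈ S`): if `qr_q(ℓ) = 0` for all `ℓ ∈ S` then `qr_q(e' − e) = 0`. [folklore] -/
theorem qrBit_sub_roots_eq_zero_of_intCast {e e' : ℚ} {n n' : ℤ} (hn : (n : ℚ) = 4 * e) (hn' : (n' : ℚ) = 4 * e')
    (hlt : e < e') (S : Finset ℕ) (h2S : 2 ∈ S)
    (hgood : ∀ ℓ : ℕ, (hℓ : ℓ.Prime) → ℓ ∉ S → haveI : Fact ℓ.Prime := ⟨hℓ⟩; padicValRat ℓ (e - e') = 0)
    (hR2 : ∀ ℓ ∈ S, qrBit q (ℓ : ℚ) = 0) : qrBit q (e' - e) = 0 := by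
  have hpos : 0 < n' - n := by
    have : (0 : ℚ) < (n' : ℚ) - n := by rw [hn, hn']; linarith
    exact_mod_cast this
  obtain ⟨k, hk⟩ := Int.eq_ofNat_of_zero_le hpos.le
  have hk0 : k ≠ 0 := by rintro rfl; simp at hk; omega
  have hsub : e' - e = ((k : ℕ) : ℚ) * ((1 / 2) * (1 / 2)) := by
    rw [show ((k : ℕ) : ℚ) = ((k : ℤ) : ℚ) by push_cast; rfl, ← hk]; push_cast; rw [hn, hn']; ring
  have hkq : ((k : ℕ) : ℚ) ≠ 0 := by exact_mod_cast hk0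
  have hR : ∀ ℓ : ℕ, ℓ.Prime → ℓ ∣ k → qrBit q (ℓ : ℚ) = 0 := by
    intro ℓ hℓ hdvd
    by_cases hℓS : ℓ ∈ S
    · exact hR2 ℓ hℓS
    · exfalso
      haveI : Fact ℓ.Prime := ⟨hℓ⟩
      have hℓ2 : ℓ ≠ 2 := fun h2 => hℓS (h2 ▸ h2S)
      have hv := hgood ℓ hℓ hℓS
      have h4 : padicValRat ℓ (4 : ℚ) = 0 := by
        rw [show (4 : ℚ) = ((4 : ℕ) : ℚ) by norm_num, padicValRat.of_nat]
        have : padicValNat ℓ 4 = 0 := padicValNat.eq_zero_of_not_dvd fun hd =>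
          hℓ2 ((Nat.prime_dvd_prime_iff_eq hℓ Nat.prime_two).mp (hℓ.dvd_of_dvd_pow (by simpa using hd : ℓ ∣ 2 ^ 2)))
        rw [this]; rfl
      have hnn0 : n - n' ≠ 0 := by omega
      have hee : e - e' = ((n - n' : ℤ) : ℚ) / 4 := by push_cast; rw [hn, hn']; ring
      rw [hee, padicValRat.div (by exact_mod_cast hnn0) (by norm_num), h4, sub_zero, padicValRat.of_int] at hv
      have h0 : padicValInt ℓ (n - n') = 0 := by exact_mod_cast hv
      rcases padicValInt.eq_zero_iff.mp h0 with h1 | h1 | h1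
      · exact hℓ.ne_one h1
      · exact hnn0 h1
      · apply h1
        rw [show n - n' = -(k : ℤ) by rw [← hk]; ring, dvd_neg]
        exact Int.natCast_dvd_natCast.mpr hdvd
  rw [hsub, qrBit_mul q hkq (by norm_num), qrBit_mul_self, add_zero, qrBit_natCast_eq_zero_of_forall_prime_dvd k hk0 hR]

end Trivial

/-! ## Local squares and the unramified count -/

section Local

/-- Parity of `x² · u` at `ℓ` for an `ℓ`-unit `u`: even. [folklore] -/
theorem parityBit_sq_mul {ℓ : ℕ} [Fact ℓ.Prime] {x u : ℚ} (hx : x ≠ 0) (hu : u ≠ 0) (hvu : padicValRat ℓ u = 0) :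
    parityBit ℓ (x ^ 2 * u) = 0 := by
  rw [parityBit_eq_zero_iff, padicValRat.mul (pow_ne_zero 2 hx) hu, padicValRat.pow x, hvu]
  exact ⟨padicValRat ℓ x, by push_cast; ring⟩

/-- `x² · u` is a square in `ℚ_v` (`v` over an odd prime `ℓ`) when `u` is an `ℓ`-unit residue.
[cite: SilvermanAEC2009, Prop. X.4.9] -/
theorem isSquare_adicCompletion_sq_mul_of_bits (v : HeightOneSpectrum (𝓞 ℚ)) {ℓ : ℕ} [Fact ℓ.Prime]
    (hv : (primesEquiv v : ℕ) = ℓ) (hℓ2 : ℓ ≠ 2) {x u : ℚ} (hx : x ≠ 0) (hu : u ≠ 0) (hvu : padicValRat ℓ u = 0)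
    (hqu : qrBit ℓ u = 0) : IsSquare (algebraMap ℚ (v.adicCompletion ℚ) (x ^ 2 * u)) := by
  refine isSquare_algebraMap_adicCompletion_of_bits v hv hℓ2 (mul_ne_zero (pow_ne_zero 2 hx) hu)
    (parityBit_sq_mul hx hu hvu) ?_
  rw [qrBit_mul ℓ (pow_ne_zero 2 hx) hu, sq, qrBit_mul_self, zero_add, hqu]

/-- `v_ℓ(q₁ q₂) = 0` for primes `ℓ ∉ {q₁, q₂}`. [folklore] -/
theorem padicValRat_mul_primes_eq_zero {ℓ q₁ q₂ : ℕ} [Fact ℓ.Prime] [Fact q₁.Prime] [Fact q₂.Prime] (h₁ : ℓ ≠ q₁)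
    (h₂ : ℓ ≠ q₂) : padicValRat ℓ ((q₁ : ℚ) * q₂) = 0 := by
  have hq₁0 : (q₁ : ℚ) ≠ 0 := by exact_mod_cast (Fact.out : q₁.Prime).ne_zero
  have hq₂0 : (q₂ : ℚ) ≠ 0 := by exact_mod_cast (Fact.out : q₂.Prime).ne_zero
  rw [padicValRat.mul hq₁0 hq₂0, show (q₁ : ℚ) = ((q₁ : ℕ) : ℚ) from rfl, show (q₂ : ℚ) = ((q₂ : ℕ) : ℚ) from rfl,
    padicValRat.of_nat, padicValRat.of_nat]
  have e1 := padicValNat_primes (p := ℓ) (q := q₁) h₁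
  have e2 := padicValNat_primes (p := ℓ) (q := q₂) h₂
  rw [e1, e2]; rfl

/-- **A non-zero `q`-unramified Selmer class makes `#N_q ≠ 1`** (`N_q ∋ 0, c₀`). [cite: SilvermanAEC2009, Prop. X.1.4] -/
theorem natCard_unramified_ne_one (W : WeierstrassCurve ℚ) [W.IsElliptic] {f₁ f₂ f₃ : ℚ}
    (hW : W.toAffine.SplitTwoTorsion f₁ f₂ f₃) (q : ℕ) [Fact q.Prime] {c₀ : galH1Torsion W 2}
    (hc₀ : c₀ ∈ selmerGroup W 2) (h1 : parityHom q (kummerEquiv ℚ 2 (W.twoTorsionCharH1 hW c₀)) = 0)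
    (h2 : parityHom q (kummerEquiv ℚ 2 (W.twoTorsionCharH1 hW.swap₁₂ c₀)) = 0) (hne : c₀ ≠ 0) :
    Nat.card {c : galH1Torsion W 2 // c ∈ selmerGroup W 2 ∧
      parityHom q (kummerEquiv ℚ 2 (W.twoTorsionCharH1 hW c)) = 0 ∧
      parityHom q (kummerEquiv ℚ 2 (W.twoTorsionCharH1 hW.swap₁₂ c)) = 0} ≠ 1 := by
  intro hN1
  haveI : Finite {c : galH1Torsion W 2 // c ∈ selmerGroup W 2 ∧
      parityHom q (kummerEquiv ℚ 2 (W.twoTorsionCharH1 hW c)) = 0 ∧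
      parityHom q (kummerEquiv ℚ 2 (W.twoTorsionCharH1 hW.swap₁₂ c)) = 0} :=
    Nat.finite_of_card_ne_zero (by rw [hN1]; exact one_ne_zero)
  have h0N : (0 : galH1Torsion W 2) ∈ selmerGroup W 2 ∧
      parityHom q (kummerEquiv ℚ 2 (W.twoTorsionCharH1 hW 0)) = 0 ∧
      parityHom q (kummerEquiv ℚ 2 (W.twoTorsionCharH1 hW.swap₁₂ 0)) = 0 :=
    ⟨zero_mem _, by rw [_root_.map_zero, _root_.map_zero, _root_.map_zero],
      by rw [_root_.map_zero, _root_.map_zero, _root_.map_zero]⟩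
  let f : Bool → {c : galH1Torsion W 2 // c ∈ selmerGroup W 2 ∧
      parityHom q (kummerEquiv ℚ 2 (W.twoTorsionCharH1 hW c)) = 0 ∧
      parityHom q (kummerEquiv ℚ 2 (W.twoTorsionCharH1 hW.swap₁₂ c)) = 0} :=
    fun b => if b then ⟨c₀, hc₀, h1, h2⟩ else ⟨0, h0N⟩
  have hf : Function.Injective f := by
    intro b b' hbb'
    cases b <;> cases b'
    · rfl
    · exfalso; simp only [f, if_neg Bool.false_ne_true, if_pos, Subtype.mk.injEq] at hbb'; exact hne hbb'.symm
    · exfalso; simp only [f, if_neg Bool.false_ne_true, if_pos, Subtype.mk.injEq] at hbb'; exact hne hbb'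
    · rfl
  have hle := Nat.card_le_card_of_injective f hf
  rw [Nat.card_eq_fintype_card (α := Bool), Fintype.card_bool, hN1] at hle
  omega

end Local

end Summit.BirchSwinnertonDyer.BirchSwinnertonDyer.Theorems.GenusKolyvaginAtTwo.TorsionCellD0

end
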